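import Mathlib
import Summits.Ventures.PercRepro2.Defs
import Summits.Ventures.PercRepro2.Graph
import Summits.Ventures.PercRepro2.OneColourSwitch
import Summits.Ventures.PercRepro2.RegionHubSign
import Summits.Ventures.PercRepro2.SideSwitch
import Summits.Ventures.PercRepro2.SideSwitchFibre
import Summits.Ventures.PercRepro2.SideSwitchComps
import Summits.Ventures.PercRepro2.M9NoPocketDefs
import Summits.Ventures.PercRepro2.M9NoPocketWorld
import Summits.Ventures.PercRepro2.M9NoPocketWorldD
import Summits.Ventures.PercRepro2.M9NoPocketLegal
import Summits.Ventures.PercRepro2.M9NoPocketFibre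
import Summits.Ventures.PercRepro2.M9NoPocketCompl
import Summits.Ventures.PercRepro2.M9NoPocketFreeBlock
import Summits.Ventures.PercRepro2.M9NoPocketFreeBlockK
import Summits.Ventures.PercRepro2.M9NoPocketDirty
import Summits.Ventures.PercRepro2.M9NoPocketHDR
import Summits.Ventures.PercRepro2.M9GeneralDSplit
import Summits.Ventures.PercRepro2.M9FourParts
import Summits.Ventures.PercRepro2.M9QuadHarrisPow
import Summits.Ventures.PercRepro2.M9NoPocketSameType
import Summits.Ventures.PercRepro2.M9NoPocketDeadPattern
import Summits.Ventures.PercRepro2.M9NoPocketLinkCompl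
import Summits.Ventures.PercRepro2.M9NoPocketSigmaRS
import Summits.Ventures.PercRepro2.M9NoPocketUnitK
import Summits.Ventures.PercRepro2.M9NoPocketUnitSum
import Summits.Ventures.PercRepro2.M9NoPocketDeadLegal

/-!
# The doubly-reached and the hub–dead-end sums in the unit coordinates (blind cell PercRepro2,
p3 g36, 2026-08-29; `proofs/P3-NPHDR.md` §5′)

Through the fibration and the same-type decomposition: `exSum` (the doubly-reached points) is
the sum over the same-type representatives of their `EX` (`exSum_eq_sum_EX`: a dead pattern has
no doubly-reached point, and the doubly-reached points of a same-type representative are the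
type-`E` points with a proper joined `W`-side set), and `hdSum` (the hub–dead-end points) is the
sum over the same-type representatives `ρ₀` of `Σ_{∅ ≠ D ≠ A} [K(ρ₀, D) + K(ρ₁, D)]`
(`hdSum_eq_sum_K`: a dead pattern's points are HD exactly when `∅ ≠ D ≠ A`, they split into the
`K`-points and the `M`-points, and the `M`-points are the `K`-points of the outside flip).
Own work; std axioms.
-/

namespace Summit.Ventures.PercRepro2

namespace NoPocket

open Finset Classical RegionHub OneColourSwitch SideSwitch M9Reduce

variable {V : Type*} {E : Type*}

section DirtySum

variable [Fintype V] [DecidableEq V] [Fintype E] [DecidableEq E] {ends : E → Sym2 V}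

/-- `d` is `W`-reached in a legal assignment exactly when it has a `W`-source. -/
lemma d_mem_M2_assignX_iff_srcW {p q r s d : V} (hnp : NoPocketAt ends d r s) (hr : d ≠ r)
    (hs : d ≠ s) {ρ : Config E} (hρ : ρ ∈ RepD ends p q r s d)
    {x : Finset (Finset V) × Finset E} (hx : x ∈ L4 ends d r s ρ) :
    d ∈ M2 ends r s (assignX ends x ρ) ↔ srcW ends d r s ρ x := by
  obtain ⟨⟨hT1, hF⟩, hLW, _⟩ := mem_L4.1 hx
  rw [M2_assignX hnp hρ hT1 hF hr hs hLW]
  simp only [Set.mem_union, Set.mem_setOf_eq, true_and]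
  constructor
  · rintro (h | h)
    · exact absurd h (not_mem_M2_endsD hr hs _)
    · exact h
  · intro h
    exact Or.inr h

/-- A dead pattern `D ≠ ∅` has a dead edge. -/
lemma hasDead_flipF_iff {d r s : V} (hnp : NoPocketAt ends d r s) (hr : d ≠ r) (hs : d ≠ s)
    (hT : Tset ends d r s = ∅) (hloop : ∀ e, ends e ≠ s(d, d)) {ρ₀ : Config E}
    (hst : ∀ e, d ∈ ends e → ρ₀ e = true) {D : Finset E} (hD : ∀ e ∈ D, d ∈ ends e) :
    hasDead ends d r s (flipF D ρ₀) ↔ D ≠ ∅ := by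
  constructor
  · rintro ⟨C, _, hW⟩ h0
    obtain ⟨e, heD, _⟩ := (hasW_flipF_iff hst D C).1 hW
    rw [h0] at heD
    exact Finset.notMem_empty e heD
  · intro h0
    obtain ⟨e, heD⟩ := Finset.nonempty_iff_ne_empty.2 h0
    obtain ⟨C, hC, y, hy, hends⟩ := exists_block_of_edge_at_d hnp hr hs hT hloop ρ₀ (hD e heD)
    refine ⟨C, by rw [blocks_flipF hD]; exact hC, (hasW_flipF_iff hst D C).2 ⟨e, heD, y, hy, hends⟩⟩

/-- A dead pattern `D ≠ A` has a source. -/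
lemma hasSource_flipF_iff {d r s : V} (hnp : NoPocketAt ends d r s) (hr : d ≠ r) (hs : d ≠ s)
    (hT : Tset ends d r s = ∅) (hloop : ∀ e, ends e ≠ s(d, d)) {ρ₀ : Config E}
    (hst : ∀ e, d ∈ ends e → ρ₀ e = true) {D : Finset E}
    (hD : D ⊆ univ.filter (fun e => d ∈ ends e)) :
    hasSource ends d r s (flipF D ρ₀) ↔ D ≠ univ.filter (fun e => d ∈ ends e) := by
  have hDd : ∀ e ∈ D, d ∈ ends e := fun e he => (Finset.mem_filter.1 (hD he)).2
  constructor
  · rintro (hTne | ⟨C, _, hY⟩)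
    · rw [hT] at hTne
      exact absurd hTne Finset.not_nonempty_empty
    · intro hDA
      obtain ⟨e, heD, y, _, hends⟩ := (hasY_flipF_iff hst D C).1 hY
      exact heD (by rw [hDA]; exact Finset.mem_filter.2 ⟨Finset.mem_univ _,
        by rw [hends]; exact Sym2.mem_mk_left _ _⟩)
  · intro hDA
    obtain ⟨e, he, heD⟩ := Finset.exists_of_ssubset (Finset.ssubset_iff_subset_ne.2 ⟨hD, hDA⟩)
    obtain ⟨C, hC, y, hy, hends⟩ :=
      exists_block_of_edge_at_d hnp hr hs hT hloop ρ₀ (Finset.mem_filter.1 he).2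
    exact Or.inr ⟨C, by rw [blocks_flipF hDd]; exact hC,
      (hasY_flipF_iff hst D C).2 ⟨e, heD, y, hy, hends⟩⟩

/-- **The hub–dead-end sum through the fibration**: the sum over the representatives with a
dead edge and a source of the sign sum over their legal vectors. -/
theorem hdSum_eq_sum_repD {p q r s d : V} (hnp : NoPocketAt ends d r s) (hpd : p ≠ d)
    (hqd : q ≠ d) (hr : d ≠ r) (hs : d ≠ s) :
    hdSum ends p q r s d = ∑ ρ ∈ RepD ends p q r s d,
      (if hasDead ends d r s ρ ∧ hasSource ends d r s ρ then
        ∑ x ∈ L4 ends d r s ρ,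
          sigma ends (assignX ends x ρ) p q * sigma ends (assignX ends x ρ) r s
      else 0) := by
  rw [hdSum_eq_sum_dOneSet, sum_dOne_eq_sum_repD_L4 hnp hpd hqd hr hs]
  refine Finset.sum_congr rfl (fun ρ hρ => ?_)
  by_cases hP : hasDead ends d r s ρ ∧ hasSource ends d r s ρ
  · rw [if_pos hP]
    refine Finset.sum_congr rfl (fun x hx => ?_)
    rw [if_pos ((HD_assignX_iff hnp hpd hqd hr hs hρ hx).2 hP)]
  · rw [if_neg hP]
    refine Finset.sum_eq_zero (fun x hx => ?_)
    rw [if_neg (fun h => hP ((HD_assignX_iff hnp hpd hqd hr hs hρ hx).1 h))]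

/-- **The doubly-reached sum through the fibration.** -/
theorem exSum_eq_sum_repD {p q r s d : V} (hnp : NoPocketAt ends d r s) (hpd : p ≠ d)
    (hqd : q ≠ d) (hr : d ≠ r) (hs : d ≠ s) :
    exSum ends p q r s d = ∑ ρ ∈ RepD ends p q r s d, ∑ x ∈ L4 ends d r s ρ,
      (if d ∈ K2 ends r s (assignX ends x ρ) ∧ d ∈ M2 ends r s (assignX ends x ρ) then
        sigma ends (assignX ends x ρ) p q * sigma ends (assignX ends x ρ) r s else 0) := by
  refine Eq.trans ?_ (sum_dOne_eq_sum_repD_L4 hnp hpd hqd hr hs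
    (fun ω => if d ∈ K2 ends r s ω ∧ d ∈ M2 ends r s ω then
      sigma ends ω p q * sigma ends ω r s else 0))
  unfold exSum DOneSet
  rw [Finset.sum_filter]
  refine Finset.sum_congr rfl (fun ω _ => ?_)
  by_cases h1 : sep2 ends p q r s ω <;> by_cases h2 : DOne ends r s d ω <;>
    by_cases h3 : d ∈ K2 ends r s ω ∧ d ∈ M2 ends r s ω <;> simp [h1, h2, h3]

/-- A dead pattern `D ≠ ∅` has no doubly-reached point. -/
lemma not_both_of_flipF {p q r s d : V} (hnp : NoPocketAt ends d r s) (hr : d ≠ r) (hs : d ≠ s)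
    (hT : Tset ends d r s = ∅) (hloop : ∀ e, ends e ≠ s(d, d)) {ρ₀ : Config E}
    (hρ₀ : ρ₀ ∈ RepD ends p q r s d) (hst : ∀ e, d ∈ ends e → ρ₀ e = true) {D : Finset E}
    (hD : ∀ e ∈ D, d ∈ ends e) (hD0 : D ≠ ∅) {x : Finset (Finset V) × Finset E}
    (hx : x ∈ L4 ends d r s (flipF D ρ₀)) :
    ¬ (d ∈ K2 ends r s (assignX ends x (flipF D ρ₀)) ∧
      d ∈ M2 ends r s (assignX ends x (flipF D ρ₀))) := by
  have hρD := flipF_mem_RepD hρ₀ hT hD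
  rintro ⟨hK, hM⟩
  rw [d_mem_K2_assignX_iff_srcY hnp hr hs hρD hx] at hK
  rw [d_mem_M2_assignX_iff_srcW hnp hr hs hρD hx] at hM
  obtain ⟨_, hLW, hLY⟩ := mem_L4.1 hx
  -- a dead edge into some block, switched or not: against one of the two legalities
  obtain ⟨e, heD⟩ := Finset.nonempty_iff_ne_empty.2 hD0
  obtain ⟨C, hC, y, hy, hends⟩ := exists_block_of_edge_at_d hnp hr hs hT hloop ρ₀ (hD e heD)
  have hW : hasW ends d (flipF D ρ₀) C := (hasW_flipF_iff hst D C).2 ⟨e, heD, y, hy, hends⟩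
  have hCb : C ∈ blocks ends d r s (flipF D ρ₀) := by rw [blocks_flipF hD]; exact hC
  by_cases hCx : C ∈ x.1
  · exact hLY hK C hCx hW
  · exact hLW hM C hCb hCx hW

/-- **The doubly-reached points of a same-type representative are its type-`E` points with a
proper joined `W`-side set.** -/
theorem sum_ex_sameType_eq {p q r s d : V} (hnp : NoPocketAt ends d r s) (hr : d ≠ r) (hs : d ≠ s)
    (hT : Tset ends d r s = ∅) {ρ₀ : Config E} (hρ₀ : ρ₀ ∈ RepD ends p q r s d)
    (hst : ∀ e, d ∈ ends e → ρ₀ e = true) {𝔉 𝔑 : Finset (Finset V)}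
    (h𝔉 : 𝔉 = (blocks ends d r s ρ₀).filter (fun C => ¬ hasY ends d ρ₀ C))
    (h𝔑 : 𝔑 = (blocks ends d r s ρ₀).filter (hasY ends d ρ₀)) :
    ∑ x ∈ L4 ends d r s ρ₀,
      (if d ∈ K2 ends r s (assignX ends x ρ₀) ∧ d ∈ M2 ends r s (assignX ends x ρ₀) then
        sigma ends (assignX ends x ρ₀) p q * sigma ends (assignX ends x ρ₀) r s else 0) =
      ∑ T ∈ 𝔉.powerset, ∑ S ∈ 𝔑.powerset.filter (fun S => S ≠ ∅ ∧ S ≠ 𝔑),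
        sigma ends (assignX ends (T ∪ S, ∅) ρ₀) p q * sigma ends (assignX ends (T ∪ S, ∅) ρ₀) r s := by
  rw [sum_L4_sameType hT hst, sum_powerset_blocks_eq ρ₀, ← h𝔉, ← h𝔑]
  refine Finset.sum_congr rfl (fun T hTp => ?_)
  have hTf : T ⊆ (blocks ends d r s ρ₀).filter (fun C => ¬ hasY ends d ρ₀ C) := by
    rw [← h𝔉]; exact Finset.mem_powerset.1 hTp
  rw [Finset.sum_filter]
  refine Finset.sum_congr rfl (fun S hS => ?_)
  have hSj : S ⊆ (blocks ends d r s ρ₀).filter (hasY ends d ρ₀) := by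
    rw [← h𝔑]; exact Finset.mem_powerset.1 hS
  have hX : T ∪ S ⊆ blocks ends d r s ρ₀ := Finset.union_subset
    (hTf.trans (Finset.filter_subset _ _)) (hSj.trans (Finset.filter_subset _ _))
  have hx : ((T ∪ S, ∅) : Finset (Finset V) × Finset E) ∈ L4 ends d r s ρ₀ :=
    (mem_L4_sameType_iff hT hst).2 ⟨hX, rfl⟩
  -- `d ∈ K₂ ↔ S ≠ 𝔑`, `d ∈ M₂ ↔ S ≠ ∅`
  have hK : d ∈ K2 ends r s (assignX ends (T ∪ S, ∅) ρ₀) ↔ S ≠ 𝔑 := by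
    rw [d_mem_K2_assignX_sameType_iff hnp hr hs hT hρ₀ hst hX, joined_subset_union_iff ρ₀ hTf hSj,
      ← h𝔑]
  have hM : d ∈ M2 ends r s (assignX ends (T ∪ S, ∅) ρ₀) ↔ S ≠ ∅ := by
    rw [d_mem_M2_assignX_iff_srcW hnp hr hs hρ₀ hx]
    constructor
    · rintro (⟨e, he, _⟩ | ⟨C, hCx, hY⟩) h0
      · exact Finset.notMem_empty e he
      · rcases Finset.mem_union.1 hCx with hCT | hCS
        · exact (Finset.mem_filter.1 (hTf hCT)).2 hY
        · rw [h0] at hCS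
          exact Finset.notMem_empty C hCS
    · intro h0
      obtain ⟨C, hCS⟩ := Finset.nonempty_iff_ne_empty.2 h0
      exact Or.inr ⟨C, Finset.mem_union_right _ hCS, (Finset.mem_filter.1 (hSj hCS)).2⟩
  by_cases hKM : d ∈ K2 ends r s (assignX ends (T ∪ S, ∅) ρ₀) ∧
      d ∈ M2 ends r s (assignX ends (T ∪ S, ∅) ρ₀)
  · rw [if_pos hKM, if_pos ⟨hM.1 hKM.2, hK.1 hKM.1⟩]
  · rw [if_neg hKM, if_neg (fun h => hKM ⟨hK.2 h.2, hM.2 h.1⟩)]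

end DirtySum

end NoPocket

end Summit.Ventures.PercRepro2
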